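/-
Copyright (c) 2026 the pub-hodgecm-mathlib formalisation cell (harness21).  Prover seat hodgecm-mathlib-K2E3-p34 (g2), Track B «K2-LIT», engine E3, unit U4 «Keys»; PART
«U4Keys» socket :182 (U4f-χ₁-ram-one-pos), programme A_pos^{<} (Roche regime cond_F χ₁ = k+1 ≤ m+1 = cond_E χ₁), brick (B3) FIRST HALF «THE `(J_e, θ)`-TYPE
VECTOR OF A REDUCIBLE `i(χ₁, 1)`, KILLED BY `Λ_{w₀}`» — the `J_e`-twin of K2E3-p27 (g2)'s (c3) first half `K2E3BranchATypeVectorLevelN` and of ★ d0B `K2E3TypeVectorInKernelDepthZeroCM` — the SHARED currency of BOTH halves of :182 at positive depth (Branch A ★ `K2E3BranchAIrreducibleTwoDepth` uses `g = w₀`;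
Branch B O-182B, R90-C10-p05 (g2)'s memo §5 (B-1a), uses `g ∈ {1, w₀}`), typed with R90-C10-p02 (g2)'s cure (V1's witness re-typed on arrival; dealer K2E3-plan (g5) ROUND 4e,
U4-RAM TYPING RULE #2).  KERNEL module: THEOREMS ONLY (no definition, no named fact, no `sorry`, no instance, no notation).
-/
import Summits.HodgeConjecture.HodgeConjecture.Theorems.K2E3BranchAIrreducibleTwoDepth         -- ★ p863311 (B3) (this seat): `levelGroup_le_iwahori`; brings ★ V1, ★ Z2A-2, ★ V2b, ★ Z2A-3c letters, ★ p862547 datum, ★ p862709 `theta_mul_concave`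
import HarnessLib

/-!
# K2 ∕ E3 «EllipticInputs», unit U4 «Keys» — (U4f-χ₁-ram-one-pos), (B3) first half: THE `(J_e, θ)`-TYPE VECTOR OF A REDUCIBLE `i(χ₁, 1)` OVER ROCHE'S TWO-DEPTH GROUP
# «`i(χ₁, 1)` reducible, `χ₁` contracting non-unitary, cond_E `≤ m+1`, cond_F `≤ k+1` ⟹ some `f′` with `f′(1) ≠ 0`, `J_e`-eigen for `θ = χ₁(·₀₀)`, and `Λ_{w₀}(f′) = ∫_N f′(w₀ n w₀) dn = 0`»
# [Casselman1995 §6.4, Thm 3.3.3; Roche1998 §3; MoyPrasad1996 §3; Keys1984 §3]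

Cell hodgecm-mathlib, Track B «K2-LIT», engine E3, crux item H413 = `stmt-HodgeConjecture-24833` (route `HCCMUnconditional`); line `K2_E3_EllipticInputs`, PART «U4Keys»
socket :182 `sig_K2E3KeysThmTwoContractingRamifiedCharOnePosDepth`, regime A_pos (memos `K2/K2E3-p37/g0/CENSUS-U4f-PosDepth…md` §9, `K2/K2E3-p34/g2/CENSUS-Apos-lt-shells.md`,
`K2/K2E3-p37/g2/MEMO-PosA-Recut…md`).  `--supports stmt-HodgeConjecture-24833 --as helper`; THEOREMS ONLY; NOT the :182 payer.  Consumed by O-182B's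
Casselman pair (B_pos) and available to any Branch-A caller (★ `K2E3BranchAIrreducibleTwoDepth` runs ★ p863059's generic engine directly).

THE POINT.  Design D-I «vanishing functional» at POSITIVE depth on `G = U(Φ₃)(L⁺_v)` in the (G3)-EXPLICIT frame, with Roche's two-depth group `J_e = eA⁻¹(Jg)`,
`e = (0 r₁ s₁; r₂ 0 r₁; s₂ r₂ 0)` (★ D174 p862387; letters `Jg hJg Je hJe`), in place of `I` — the first four arrows of the ★ depth-zero template `K2E3BranchAIrreducibleDepthZero`
(and of K2E3-p27's (c3) first half at the uniform level `J_{m+1}`): suppose `i(χ₁, 1)` reducible; ★ V1 gives a `G`-stable `V ∋ f`, `f(1) ≠ 0`, killed by `Λ_{w₀}`; ★ p862547 the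
Iwahori datum `𝓘` with `𝓘.K 0 = J_e`, `𝓘.K 1 = I`, `𝓘.N̄ = eA⁻¹(N̄_w)`; ★ Z2A-2 (level `0`) a dilate of `f` in `V` fixed by `J_e ∩ N̄`; ★ V2b with `hθmul` = ★ p862709
`theta_mul_concave` (letters `hcond` at `m + 1`, `hcondF` at `k + 1` on the `(c ⊗ 1)`-fixed units, a trace-one `t`, the concavity `m+1 ≤ r₁+r₂`, `m+1 ≤ 2r₁+s₂`, `m+1 ≤ s₁+2r₂`,
`k+1 ≤ s₁+s₂`), `hθH` = ★ `theta_eq_tau_of_mem` (on `P ∩ J_e ⊆ P ∩ I`, ★ p863311 `levelGroup_le_iwahori`), `hθC` = ★ `theta_eq_one_of_map_mem`, `hBC` = ★ `exists_mem_P_mul_of_mem` — the `(J_e, θ)`-TYPE VECTOR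
`f′ ∈ V` with `f′(1) ≠ 0`, hence `Λ_{w₀}(f′) = 0`.
* **`exists_typeVector_twoDepth`** — `∃ f′`, `f′(1) ≠ 0`, `∀ b ∈ J_e, b·f′ = θ(b) f′`, `∀ g, ∫_N f′(w₀ n g) dμ = 0` (the kernel clause for EVERY `g`,
  as ★ d0B `K2E3TypeVectorInKernelDepthZeroCM` exports it — R90-C10-p05 (g2)'s one-letter ask 2026-09-04T23:29Z; the inducing representation and `θ` spelled out).
HONEST LABEL: HC_CM is proved only modulo the 7 printed citations (2 remaining named inputs: hLiu418 = stmt-HodgeConjecture-24832, h413 = stmt-HodgeConjecture-24833) until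
rung 0 closes; count-neutral — this file does NOT pay the leaf; :182 stays OPEN.

## References
* [Keys1984] D. Keys, *Principal series representations of special unitary groups over local fields*, Compositio Math. 51 (1984), §3, §7 Thm (2).
* [Roche1998] A. Roche, *Types and Hecke algebras for principal series representations of split reductive p-adic groups*, Ann. Sci. ÉNS (4) 31 (1998), §3–§4.
* [Casselman1995] W. Casselman, *Introduction to the theory of admissible representations of `p`-adic reductive groups* (1995), §6.3–§6.4.
* [MoyPrasad1996] A. Moy, G. Prasad, *Jacquet functors and unrefined minimal K-types*, Comment. Math. Helv. 71 (1996), §3.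
* [BruhatTits1972] F. Bruhat, J. Tits, Publ. Math. IHÉS 41 (1972), (4.4.4), (6.4.9).
-/

set_option autoImplicit false
-- the mandated namespace has the single-problem summit's repeated segment (`HodgeConjecture.HodgeConjecture`)
set_option linter.dupNamespace false

noncomputable section

open NumberField IsDedekindDomain MeasureTheory
open scoped Matrix MatrixGroups WithZero Valued
open Literature.NumberTheory Literature.NumberTheory.Automorphic Literature.NumberTheory.Automorphic.UnitaryGroup
open Literature.NumberTheory.Rogawski1990

namespace Summit.HodgeConjecture.HodgeConjecture.Cruxes.H413.K2E3BranchATypeVectorTwoDepth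

open Summit.HodgeConjecture.HodgeConjecture.Cruxes.H413
open Summit.HodgeConjecture.HodgeConjecture.Cruxes.H413.K2E3BranchATypeLettersCM
open Summit.HodgeConjecture.HodgeConjecture.Cruxes.H413.K2E3ConcaveLevelIwahoriCharacterCM
open Summit.HodgeConjecture.HodgeConjecture.Cruxes.H413.K2E3BranchAIrreducibleTwoDepth

variable (L : Type) [Field L] [NumberField L] [IsCMField L] (v : HeightOneSpectrum (𝓞 ↥(maximalRealSubfield L)))
  (w : PlacesOver L v) (hw : IsCMField.complexConj L • w.1 = w.1)
  (eA : Gqs L v ≃ₜ* ↥(unitaryGroupOfForm (galAdicCompletionMap (L := L) (IsCMField.complexConj L) hw) ((StdForm.antidiagonal 3).over (w.1.adicCompletion L))))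
  (heA : ∀ g : Gqs L v,
    ((eA g : ↥(unitaryGroupOfForm (galAdicCompletionMap (L := L) (IsCMField.complexConj L) hw) ((StdForm.antidiagonal 3).over (w.1.adicCompletion L)))) :
        GL (Fin 3) (w.1.adicCompletion L)) =
      ((localNonsplitEquiv (IsCMField.complexConj L) (qsForm L) (IsCMField.complexConj_ne_one L) w hw g :
        ↥(unitaryGroupOfForm (galAdicCompletionMap (L := L) (IsCMField.complexConj L) hw) (placeForm (qsForm L) w.1))) : GL (Fin 3) (w.1.adicCompletion L)))
  {ϖ : w.1.adicCompletion L} (hϖ : Valued.v ϖ = WithZero.exp (-1 : ℤ))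
  (g₁ : GL (Fin 3) (w.1.adicCompletion L)) (hg₁ : (g₁ : Matrix (Fin 3) (Fin 3) (w.1.adicCompletion L)) = Matrix.diagonal ![(1 : w.1.adicCompletion L), 1, ϖ])
  (K0 K1 I : Subgroup (Gqs L v))
  (hK0 : K0 = ((glInt 3 (w.1.adicCompletion L)).subgroupOf
    (unitaryGroupOfForm (galAdicCompletionMap (L := L) (IsCMField.complexConj L) hw) ((StdForm.antidiagonal 3).over (w.1.adicCompletion L)))).comap
      eA.toMulEquiv.toMonoidHom)
  (hK1 : K1 = (((glInt 3 (w.1.adicCompletion L)).map (MulAut.conj g₁).toMonoidHom).subgroupOf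
    (unitaryGroupOfForm (galAdicCompletionMap (L := L) (IsCMField.complexConj L) hw) ((StdForm.antidiagonal 3).over (w.1.adicCompletion L)))).comap
      eA.toMulEquiv.toMonoidHom)
  (hI : I = K0 ⊓ K1)
  (r₁ s₁ r₂ s₂ : ℕ)
  (Jg : Subgroup ↥(unitaryGroupOfForm (galAdicCompletionMap (L := L) (IsCMField.complexConj L) hw) ((StdForm.antidiagonal 3).over (w.1.adicCompletion L))))
  (hJg : ∀ k : ↥(unitaryGroupOfForm (galAdicCompletionMap (L := L) (IsCMField.complexConj L) hw) ((StdForm.antidiagonal 3).over (w.1.adicCompletion L))),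
    k ∈ Jg ↔ ∀ i j, Valued.v (((k : GL (Fin 3) (w.1.adicCompletion L)) : Matrix (Fin 3) (Fin 3) (w.1.adicCompletion L)) i j) ≤
      Valued.v ϖ ^ (![![0, r₁, s₁], ![r₂, 0, r₁], ![s₂, r₂, 0]] : Fin 3 → Fin 3 → ℕ) i j)
  (Je : Subgroup (Gqs L v)) (hJe : Je = Jg.comap eA.toMulEquiv.toMonoidHom)

/-! ## The `(J_e, θ)`-type vector of a reducible `i(χ₁, 1)`, in the kernel of every `Λ_g` -/

open Classical in
include hw heA hϖ hg₁ hK0 hK1 hI hJg hJe in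
set_option maxHeartbeats 4000000 in
set_option synthInstance.maxHeartbeats 400000 in
-- ★ d0B `K2E3TypeVectorInKernelDepthZeroCM`'s measured class (staged applications ≈ 3 min at 4 M; the unstaged form timed out at 1.6 M ∕ 16 M here): V1 re-typed on arrival, ★ Z2A-2 ∕ ★ V2b staged
/-- **THE `(J_e, θ)`-TYPE VECTOR OF A REDUCIBLE `i(χ₁, 1)` (positive depth, Roche's two-depth group).**  Frame: `v` non-split (`hns`), `w ∣ v`, `eA`, a uniformiser `ϖ`, `g₁`,
`K₀`, `K₁`, `I`; `Je = eA⁻¹(Jg)`, `e = (0 r₁ s₁; r₂ 0 r₁; s₂ r₂ 0)` with `1 ≤ r₂`, `1 ≤ s₂`.  Letters: `χ₁` continuous, non-unitary, contracting; `hcond` (cond_E `≤ m + 1`), `hcondF`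
(cond_F `≤ k + 1` on the `(c ⊗ 1)`-fixed units), `k ≤ m`; a trace-one `t` with `|t| ≤ 1`; the concavity `h1`–`h4` of ★ p862709; `w₀` of matrix `Φ₃`; a Haar measure `μ` on `N(L⁺_v)`;
`i(χ₁, 1)` REDUCIBLE.  Then there is `f′` in the induced model (★ d0B `K2E3TypeVectorInKernelDepthZeroCM`'s export shape VERBATIM, `I ↦ J_e`) with `f′(1) ≠ 0`, `b · f′ = θ(b) f′` for all `b ∈ J_e` (`θ(g) = χ₁(g₀₀)` if `g₀₀` is a unit,
else `0`) and `∫_N f′(w₀ n g) dμ = 0` for every `g`: ★ V1 (witness re-typed on arrival in the `smoothIndRep` currency) → ★ p862547 datum (`K 0 = J_e`) → ★ Z2A-2 → ★ V2b (letters ★ `theta_mul_concave`, ★ `theta_eq_tau_of_mem` via §1, ★ `theta_eq_one_of_map_mem`,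
★ `exists_mem_P_mul_of_mem`), and ★ V1's vanishing of `Λ_{w₀}` on the reducing `V ∋ f′`.
[cite: Casselman1995, §6.4] [cite: Roche1998, §3] [cite: MoyPrasad1996, §3] [cite: Keys1984, §3, §7 Thm (2)] [cite: BruhatTits1972, (6.4.9)] -/
theorem exists_typeVector_twoDepth (h10 : 1 ≤ r₂) (h20 : 1 ≤ s₂)
    (hns : ∀ w' : PlacesOver L v, IsCMField.complexConj L • w'.1 = w'.1)
    (χ₁ : (LocalRing L v)ˣ →* ℂˣ) (h₁ : Continuous fun x => ((χ₁ x : ℂˣ) : ℂ)) (hnu : ∃ x, ‖((χ₁ x : ℂˣ) : ℂ)‖ ≠ 1)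
    (hcontr : ∀ x : (LocalRing L v)ˣ, unitModulusChar (LocalRing L v) x < 1 → ‖((χ₁ x : ℂˣ) : ℂ)‖ < 1)
    {m k : ℕ} (hkm : k ≤ m)
    (hcond : ∀ u : (LocalRing L v)ˣ, (∀ w' : PlacesOver L v, Valued.v (((u : LocalRing L v) w') - 1) ≤ Valued.v ϖ ^ (m + 1)) → χ₁ u = 1)
    (hcondF : ∀ u : (LocalRing L v)ˣ, Units.map (conjLocal L (IsCMField.complexConj L) v : LocalRing L v →* LocalRing L v) u = u →
      (∀ w' : PlacesOver L v, Valued.v (((u : LocalRing L v) w') - 1) ≤ Valued.v ϖ ^ (k + 1)) → χ₁ u = 1)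
    {t : w.1.adicCompletion L} (ht : t + galAdicCompletionMap (L := L) (IsCMField.complexConj L) hw t = 1) (hvt : Valued.v t ≤ 1)
    (h1 : m + 1 ≤ r₁ + r₂) (h2 : m + 1 ≤ 2 * r₁ + s₂) (h3 : m + 1 ≤ s₁ + 2 * r₂) (h4 : k + 1 ≤ s₁ + s₂)
    (w₀ : ↥(unitaryGroupOfForm (conjLocal L (IsCMField.complexConj L) v) (cmLocalForm L 3 v))) (hw₀ : Units.val (w₀ : GL (Fin 3) (LocalRing L v)) = cmLocalForm L 3 v)
    [MeasurableSpace ↥(cmBorelTriple L 3 v).N] [BorelSpace ↥(cmBorelTriple L 3 v).N] (μ : Measure ↥(cmBorelTriple L 3 v).N) [μ.IsHaarMeasure]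
    (hred : ∃ N : Subrepresentation (cmPrincipalSeries L 3 v (cmTorusCharPair L v χ₁ 1)), N ≠ ⊥ ∧ N ≠ ⊤) :
    haveI := locallyCompactSpace_cmBorelU L 3 v
    ∃ f' : Representation.SmoothInd (cmBorelTriple L 3 v).P
        (Representation.twist (((Representation.trivial ℂ ↥(torusU (conjLocal L (IsCMField.complexConj L) v) (cmLocalForm L 3 v)) ℂ).twist
          (cmTorusCharPair L v χ₁ 1)).comp (cmBorelTriple L 3 v).proj) (rootDeltaChar (cmBorelTriple L 3 v).P)),
      (∀ x ∈ Je, Representation.smoothIndRep _ _ x f' =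
        (if h : IsUnit (((x.val : GL (Fin 3) (LocalRing L v)) : Matrix (Fin 3) (Fin 3) (LocalRing L v)) 0 0) then ((χ₁ h.unit : ℂˣ) : ℂ) else 0) • f') ∧
      f'.toFun 1 ≠ 0 ∧
      ∀ g : ↥(unitaryGroupOfForm (conjLocal L (IsCMField.complexConj L) v) (cmLocalForm L 3 v)),
        ∫ n : ↥(cmBorelTriple L 3 v).N, f'.toFun (w₀ * (n : ↥(unitaryGroupOfForm (conjLocal L (IsCMField.complexConj L) v) (cmLocalForm L 3 v))) * g) ∂μ = 0 := by
  haveI := locallyCompactSpace_cmBorelU L 3 v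
  -- the exponent matrix `e = (0 r₁ s₁; r₂ 0 r₁; s₂ r₂ 0)`: zero diagonal, anti-transpose symmetric
  have he0 : ∀ i : Fin 3, (![![0, r₁, s₁], ![r₂, 0, r₁], ![s₂, r₂, 0]] : Fin 3 → Fin 3 → ℕ) i i = 0 := fun i => by
    fin_cases i <;> rfl
  have hsym : ∀ i j : Fin 3, (![![0, r₁, s₁], ![r₂, 0, r₁], ![s₂, r₂, 0]] : Fin 3 → Fin 3 → ℕ) (Fin.rev j) (Fin.rev i) =
      (![![0, r₁, s₁], ![r₂, 0, r₁], ![s₂, r₂, 0]] : Fin 3 → Fin 3 → ℕ) i j := fun i j => by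
    fin_cases i <;> fin_cases j <;> rfl
  -- ★ p863311 §1: `J_e ≤ I`
  have hJI : Je ≤ I := levelGroup_le_iwahori L v w hw eA hϖ g₁ hg₁ K0 K1 I hK0 hK1 hI r₁ s₁ r₂ s₂ Jg hJg Je hJe h10 h20
  -- ★ V1: a `G`-stable `V ∋ f`, `f(1) ≠ 0`, killed by the intertwining functional `Λ_{w₀}`
  have h₂ : Continuous fun x : ↥(normOneUnits (conjLocal L (IsCMField.complexConj L) v)) =>
      (((1 : ↥(normOneUnits (conjLocal L (IsCMField.complexConj L) v)) →* ℂˣ) x : ℂˣ) : ℂ) := by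
    simp only [MonoidHom.one_apply]; exact continuous_const
  obtain ⟨V, f, hfV, hf1, hΛ⟩ : ∃ (V : Subrepresentation (Representation.smoothIndRep (cmBorelTriple L 3 v).P
      (Representation.twist
      (((Representation.trivial ℂ ↥(torusU (conjLocal L (IsCMField.complexConj L) v) (cmLocalForm L 3 v)) ℂ).twist
        (cmTorusCharPair L v χ₁ 1)).comp (cmBorelTriple L 3 v).proj) (rootDeltaChar (cmBorelTriple L 3 v).P))))
      (f : Representation.SmoothInd (cmBorelTriple L 3 v).P
      (Representation.twist
      (((Representation.trivial ℂ ↥(torusU (conjLocal L (IsCMField.complexConj L) v) (cmLocalForm L 3 v)) ℂ).twist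
        (cmTorusCharPair L v χ₁ 1)).comp (cmBorelTriple L 3 v).proj) (rootDeltaChar (cmBorelTriple L 3 v).P))),
      f ∈ V ∧ f.toFun 1 ≠ 0 ∧ ∀ f', f' ∈ V → ∀ g : ↥(unitaryGroupOfForm (conjLocal L (IsCMField.complexConj L) v) (cmLocalForm L 3 v)),
        ∫ n : ↥(cmBorelTriple L 3 v).N, f'.toFun (w₀ * (n : ↥(unitaryGroupOfForm (conjLocal L (IsCMField.complexConj L) v) (cmLocalForm L 3 v))) * g) ∂μ = 0 :=
    K2E3IntertwiningKernelOfReducible.exists_section_apply_one_ne_zero_forall_intertwiningIntegral_eq_zero L v hns χ₁ 1 h₁ h₂ hnu hcontr hred w₀ hw₀ μ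
  -- ★ p862547: the Iwahori datum with `K 0 = J_e`, `K 1 = I`, `N̄ = eA⁻¹(N̄_w)`
  obtain ⟨𝓘, hK0J, -, hNbar⟩ := K2E3IwahoriTwoDepthLettersCM.exists_iwahoriDatum_K_zero_eq_levelGroup L v w hw eA heA hϖ g₁ hg₁ K0 K1 I hK0 hK1 hI
    _ Jg hJg Je hJe he0 hsym h10 h20
  subst hK0J
  -- ★ Z2A-2 at level `0`: a dilate of `f` inside `V`, non-zero at `1`, fixed by `J_e ∩ N̄` — the application is STAGED (`@`-explicit carrier and inducing character, one
  -- argument per `have`; ★ d0B `K2E3TypeVectorInKernelDepthZeroCM`'s measured pattern: in one piece the ★ Z2A-5 class costs minutes of unification, staged seconds)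
  have d0 := @K2E3IwahoriDatumDilation.exists_dilate_typeReady ↥(unitaryGroupOfForm (conjLocal L (IsCMField.complexConj L) v) (cmLocalForm L 3 v)) _ _ _ (cmBorelTriple L 3 v).P
    (Representation.twist (((Representation.trivial ℂ ↥(torusU (conjLocal L (IsCMField.complexConj L) v) (cmLocalForm L 3 v)) ℂ).twist
          (cmTorusCharPair L v χ₁ 1)).comp (cmBorelTriple L 3 v).proj) (rootDeltaChar (cmBorelTriple L 3 v).P))
    (cmBorelTriple L 3 v) 𝓘
  have d1 := d0 (cmBorelTriple L 3 v).M_le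
  have d2 := d1 V
  have d3 := d2 f
  have d4 := d3 hfV
  have d5 := d4 hf1 0
  obtain ⟨i, hf₁V, hf₁1, hf₁fix⟩ := d5
  -- ★ V2b: the `(J_e, θ)`-type vector in `V` (staged likewise; `hθmul` = ★ p862709 `theta_mul_concave`, `hθH` = ★ `theta_eq_tau_of_mem` via §1, `hθC` = ★ `theta_eq_one_of_map_mem`)
  have e0 := @K2E3TypeVectorOfSubrepFactored.exists_typeVector_of_mem_of_factored ↥(unitaryGroupOfForm (conjLocal L (IsCMField.complexConj L) v) (cmLocalForm L 3 v)) _ _ _ (cmBorelTriple L 3 v).P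
    (Representation.twist (((Representation.trivial ℂ ↥(torusU (conjLocal L (IsCMField.complexConj L) v) (cmLocalForm L 3 v)) ℂ).twist
          (cmTorusCharPair L v χ₁ 1)).comp (cmBorelTriple L 3 v).proj) (rootDeltaChar (cmBorelTriple L 3 v).P))
    (𝓘.K 0) (𝓘.K 0 ⊓ 𝓘.Nbar) (𝓘.isCompact_K 0)
  have e1 := e0 (fun b hb => exists_mem_P_mul_of_mem _ 𝓘 0 hb)
  have e2 := e1 (fun g : ↥(unitaryGroupOfForm (conjLocal L (IsCMField.complexConj L) v) (cmLocalForm L 3 v)) =>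
    if h : IsUnit (((g : GL (Fin 3) (LocalRing L v)) : Matrix (Fin 3) (Fin 3) (LocalRing L v)) 0 0) then ((χ₁ h.unit : ℂˣ) : ℂ) else 0)
  have e3 := e2 (fun x hx y hy => theta_mul_concave L v w hw eA heA hϖ _ Jg hJg (𝓘.K 0) hJe h10 h20 χ₁ (Nat.succ_le_succ (Nat.zero_le k)) (Nat.succ_le_succ hkm)
    hcond hcondF ht hvt h1 h2 h3 h4 hx hy)
  have e4 := e3 (fun p hp hpI => theta_eq_tau_of_mem L v w hw eA heA hϖ g₁ hg₁ K0 K1 I hK0 hK1 hI χ₁ p hp (hJI hpI))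
  have e5 := e4 (fun c hc _ => theta_eq_one_of_map_mem L v w hw eA heA χ₁ (by
      have h := (Subgroup.mem_inf.1 hc).2
      rw [hNbar] at h
      exact h))
  have e6 := e5 V
  have e7 := e6 _ hf₁V
  have e8 := e7 hf₁1
  have e9 := e8 (fun c hc _ => hf₁fix c hc)
  obtain ⟨f', hf'V, hf'1, heig⟩ := e9
  exact ⟨f', heig, hf'1, fun g => hΛ f' hf'V g⟩

end Summit.HodgeConjecture.HodgeConjecture.Cruxes.H413.K2E3BranchATypeVectorTwoDepth

end
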